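import Summits.QuantumFields.GaugeBoot.ConjugationSymmetry
import Summits.QuantumFields.GaugeBoot.LoopEquation
import Summits.QuantumFields.GaugeBoot.WordLoop
import Summits.QuantumFields.GaugeBoot.SU3PairIdentity
import HarnessLib

/-!
# The `SU(3)` kinematical rows at the level of torus expectations (cell `gauge-boot`, seat lean2, desk item)

Honest framing (cell rule): certified bounds on lattice expectations at stated coupling, gauge group, dimension and
torus size; NOT a mass gap, NOT a continuum limit, NOT a string tension, NOT large `N`; not summit-bearing
(`FixedCouplingUltralocality`, `PerturbativeInvisibility`).  This file enters NO bound, NO certificate and NO index row;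
it is item §3(c) of the lane's design note `SU3-ROWS-DESIGN.md` (the rows engine §3(b)/(d) has no ruling, not started).

The `SU(3)` loop-equation systems of this cell carry, besides the single-link Schwinger–Dyson rows, β-INDEPENDENT
("kinematical") equality rows among their variables `w(C) = ⟨(1/3) Re tr hol C⟩_β` (single loops) and
`d(A, B) = Re ⟨tr hol A · tr hol B⟩_β / 9` (positioned pairs at a common base point): the NEWTON rows of every rung and,
in the kinematical audit (KIN-CENSUS-G1 §H–§K), the instances of ONE pointwise `SL₃` identity, the pair identity
`T1:  tr X⁻¹ · tr Y = tr (X⁻¹ Y) + tr X · tr (X Y) − tr (X² Y)` (`det X = 1`), kernel-checked POINTWISE in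
`SU3PairIdentity.lean` (`su_three_pair_identity`).  What was not kernel-checked is the
step from the pointwise identity to the equality row among TORUS EXPECTATIONS: integration against Wilson's measure
and the charge-conjugation average that makes every variable real.  This file does that step, for lattice `SU(3)`
Yang–Mills (fundamental representation, tree coupling `β`) on the torus `(ℤ/L)^d`, every real `β`, every `d`, every
`L ≥ 1`, for a CLOSED word `X` at `x` and ANY word `Y` read from `x`:

* `su3_pair_identity_wordHolonomy` — T1 pointwise on configurations, in words:
  `conj(tr hol X) · tr hol Y = tr hol(X⁻¹Y) + tr hol X · tr hol(XY) − tr hol(X²Y)` (`X⁻¹Y = reverse X ++ Y`, …);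
* `su3_integral_pair_identity` — the same among complex torus expectations (T1-E);
* `su3_t1_row` — the generators' REAL normal form `d(X⁻¹, Y) − d(X, XY) − w(X⁻¹Y)/3 + w(X²Y)/3 = 0`, written out with
  `w(C) = wilsonExpectation ρ β (wordLoop ρ x C)` (tree `wordLoop` = `(1/3) Re tr`) and `d(A, B) = Re E[tr A · tr B]/9`
  (no new definition is introduced);
* its two named instances exactly as the problems of record carry them: `su3_newton_row`
  (`d(X, X) = w(X²)/3 + 2 w(X)/3`; for the plaquette word, `su3_newton_row_plaquette`, this is the one kinematical
  equality row of the rung-0 `SU(3)` problems) and `su3_modulus_row` (`d(X, X⁻¹) = d(X², X) − w(X³)/3 + 1/3`);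
* on the way, for general `N`: `tr hol(w⁻¹) = conj tr hol(w)` (`trace_fundamentalRep_inv`,
  `trace_wordHolonomy_reverse_closed`), integrability of products of loop traces, the charge-conjugation identities
  `E[tr A · conj tr B] = E[conj tr A · tr B] = E[tr A · tr B⁻¹]` with vanishing imaginary parts
  (`integral_trace_mul_conj_trace_comm`, `im_integral_conj_trace_mul_trace_eq_zero`, …) from `ConjugationSymmetry`,
  JOINT-reversal invariance of the pair variable `Re E[tr A⁻¹ · tr B⁻¹] = Re E[tr A · tr B]`
  (`re_integral_trace_reverse_mul_trace_reverse_closed`; the generators' pair classes are taken modulo swap × joint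
  reversal), `E[Re(tr A · tr B)] = Re E[tr A · tr B]` (`integral_re_trace_mul_trace`) and `w(C) = (1/N) Re E[tr hol C]`
  (`wilsonExpectation_wordLoop_eq_re_integral`).

Instance bookkeeping (which loops, orbit sizes, problem labels) remains the generators' (G1 `kin_su3audit_g1`,
G2 `t1_tier_g2`); nothing here is a certificate row.  Everything is `[folklore]`: Cayley–Hamilton / Mandelstam
constraints for `SU(3)` Wilson loops (S. Mandelstam, Phys. Rev. D 19 (1979) 2391; Guo–Li–Yang–Zhu arXiv:2502.14421
App. A; Kazakov–Zheng arXiv:2404.16925 §2.3) and `C`-invariance of the Wilson action (Montvay–Münster §3.2).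
-/

noncomputable section

open MeasureTheory
open scoped Matrix ComplexConjugate
open Literature.MathematicalPhysics.QuantumFieldTheory
open Literature.MathematicalPhysics.QuantumLattice

namespace Summit.QuantumFields.GaugeBoot

/-! ## Pointwise algebra (general `N`) -/

section Pointwise

variable (N : ℕ) {d L : ℕ}

/-- `tr ρ(g⁻¹) = conj tr ρ(g)` in the fundamental representation of `SU(N)` (`g⁻¹ = g†`). [folklore] -/
theorem trace_fundamentalRep_inv (g : Matrix.specialUnitaryGroup (Fin N) ℂ) :
    (fundamentalRep (Fin N) g⁻¹).trace = conj (fundamentalRep (Fin N) g).trace := by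
  rw [fundamentalRep_apply, fundamentalRep_apply, ← Matrix.star_eq_inv, Matrix.specialUnitaryGroup.coe_star,
    Matrix.star_eq_conjTranspose, Matrix.trace_conjTranspose, Complex.star_def]

/-- `tr hol_{x'}(w⁻¹) = conj tr hol_x(w)` (`x'` the endpoint of `w`). [folklore] -/
theorem trace_wordHolonomy_reverse_eq_conj (U : GaugeConfig d L (Matrix.specialUnitaryGroup (Fin N) ℂ))
    (x : Site d L) (w : Word d) :
    (fundamentalRep (Fin N) (wordHolonomy U (Word.endpoint x w) (Word.reverse w))).trace =
      conj (fundamentalRep (Fin N) (wordHolonomy U x w)).trace := by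
  rw [wordHolonomy_reverse, trace_fundamentalRep_inv]

/-- For a CLOSED word `w` at `x`: `tr hol_x(w⁻¹) = conj tr hol_x(w)`. [folklore] -/
theorem trace_wordHolonomy_reverse_closed (U : GaugeConfig d L (Matrix.specialUnitaryGroup (Fin N) ℂ))
    (x : Site d L) (w : Word d) (hw : Word.endpoint x w = x) :
    (fundamentalRep (Fin N) (wordHolonomy U x (Word.reverse w))).trace =
      conj (fundamentalRep (Fin N) (wordHolonomy U x w)).trace := by
  have h := trace_wordHolonomy_reverse_eq_conj N U x w
  rwa [hw] at h

variable {G : Type*} [Group G]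

/-- A closed word `X` at `x`, reversed and followed by `Y`: `hol_x(X⁻¹ Y) = hol_x(X)⁻¹ · hol_x(Y)`. [folklore] -/
theorem wordHolonomy_reverse_append_closed (U : GaugeConfig d L G) (x : Site d L) (X Y : Word d)
    (hX : Word.endpoint x X = x) :
    wordHolonomy U x (Word.reverse X ++ Y) = (wordHolonomy U x X)⁻¹ * wordHolonomy U x Y := by
  have h : wordHolonomy U (Word.endpoint x X) (Word.reverse X ++ Y) =
      (wordHolonomy U x X)⁻¹ * wordHolonomy U x Y := by
    rw [wordHolonomy_append, wordHolonomy_reverse, Word.endpoint_reverse]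
  rwa [hX] at h

/-- A closed word traversed twice and followed by `Y`: `hol_x(X X Y) = hol_x(X) · (hol_x(X) · hol_x(Y))`. [folklore] -/
theorem wordHolonomy_append_append_closed (U : GaugeConfig d L G) (x : Site d L) (X Y : Word d)
    (hX : Word.endpoint x X = x) :
    wordHolonomy U x (X ++ (X ++ Y)) = wordHolonomy U x X * (wordHolonomy U x X * wordHolonomy U x Y) := by
  rw [wordHolonomy_append, hX, wordHolonomy_append, hX]

end Pointwise

/-! ## The `SU(3)` pair identity on configurations -/

section SU3Pointwise

variable {d L : ℕ}

/-- **T1 on configurations**: for a CLOSED word `X` at `x` and any word `Y` from `x`, in lattice `SU(3)`,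
`conj(tr hol X) · tr hol Y = tr hol(X⁻¹Y) + tr hol X · tr hol(XY) − tr hol(X²Y)` — `su_three_pair_identity` with
`U = hol_x X`, `W = hol_x Y`. [folklore] -/
theorem su3_pair_identity_wordHolonomy (U : GaugeConfig d L (Matrix.specialUnitaryGroup (Fin 3) ℂ))
    (x : Site d L) (X Y : Word d) (hX : Word.endpoint x X = x) :
    conj (fundamentalRep (Fin 3) (wordHolonomy U x X)).trace * (fundamentalRep (Fin 3) (wordHolonomy U x Y)).trace =
      (fundamentalRep (Fin 3) (wordHolonomy U x (Word.reverse X ++ Y))).trace +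
        (fundamentalRep (Fin 3) (wordHolonomy U x X)).trace *
          (fundamentalRep (Fin 3) (wordHolonomy U x (X ++ Y))).trace -
        (fundamentalRep (Fin 3) (wordHolonomy U x (X ++ (X ++ Y)))).trace := by
  have h := su_three_pair_identity (wordHolonomy U x X)
    ((wordHolonomy U x Y : Matrix.specialUnitaryGroup (Fin 3) ℂ) : Matrix (Fin 3) (Fin 3) ℂ)
  have e2 : wordHolonomy U x (X ++ Y) = wordHolonomy U x X * wordHolonomy U x Y := by rw [wordHolonomy_append, hX]
  rw [wordHolonomy_reverse_append_closed U x X Y hX, wordHolonomy_append_append_closed U x X Y hX, e2]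
  simp only [fundamentalRep_apply, Submonoid.coe_mul, ← Matrix.star_eq_inv, Matrix.specialUnitaryGroup.coe_star,
    Complex.star_def, pow_two, Matrix.mul_assoc] at h ⊢
  linear_combination h

/-- **Newton on configurations** (`SU(3)`, closed `X` at `x`): `(tr hol X)² = tr hol(X²) + 2 conj(tr hol X)`
(`e₂(U) = conj e₁(U)` for `U ∈ SU(3)`; tree `su_three_two_mul_star_trace`). [folklore] -/
theorem su3_newton_wordHolonomy (U : GaugeConfig d L (Matrix.specialUnitaryGroup (Fin 3) ℂ))
    (x : Site d L) (X : Word d) (hX : Word.endpoint x X = x) :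
    (fundamentalRep (Fin 3) (wordHolonomy U x X)).trace * (fundamentalRep (Fin 3) (wordHolonomy U x X)).trace =
      (fundamentalRep (Fin 3) (wordHolonomy U x (X ++ X))).trace +
        2 * conj (fundamentalRep (Fin 3) (wordHolonomy U x X)).trace := by
  have h := su_three_two_mul_star_trace (wordHolonomy U x X)
  have e2 : wordHolonomy U x (X ++ X) = wordHolonomy U x X * wordHolonomy U x X := by rw [wordHolonomy_append, hX]
  rw [e2]
  simp only [fundamentalRep_apply, Submonoid.coe_mul, Complex.star_def, pow_two] at h ⊢
  linear_combination -h

end SU3Pointwise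

/-! ## Integrability and charge conjugation for products of loop traces (general `N`) -/

section Expectation

variable (N : ℕ) {d L : ℕ}

/-- `U ↦ tr hol_x(w)(U)` is continuous. [folklore] -/
theorem continuous_trace_fundamentalRep_wordHolonomy (x : Site d L) (w : Word d) :
    Continuous fun U : GaugeConfig d L (Matrix.specialUnitaryGroup (Fin N) ℂ) =>
      (fundamentalRep (Fin N) (wordHolonomy U x w)).trace :=
  continuous_trace_wordHolonomy (fundamentalLatticeRep N) x w

/-- `tr hol_x(w)` is integrable for Wilson's measure (every real `β`). [folklore] -/
theorem integrable_trace_wordHolonomy [NeZero L] (β : ℝ) (x : Site d L) (w : Word d) :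
    Integrable (fun U : GaugeConfig d L (Matrix.specialUnitaryGroup (Fin N) ℂ) =>
      (fundamentalRep (Fin N) (wordHolonomy U x w)).trace)
      (wilsonMeasure (d := d) (L := L) (fundamentalRep (Fin N)) β) :=
  integrable_of_continuous (fundamentalLatticeRep N) β (continuous_trace_fundamentalRep_wordHolonomy N x w)

/-- `conj tr hol_x(w)` is integrable for Wilson's measure. [folklore] -/
theorem integrable_conj_trace_wordHolonomy [NeZero L] (β : ℝ) (x : Site d L) (w : Word d) :
    Integrable (fun U : GaugeConfig d L (Matrix.specialUnitaryGroup (Fin N) ℂ) =>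
      conj (fundamentalRep (Fin N) (wordHolonomy U x w)).trace)
      (wilsonMeasure (d := d) (L := L) (fundamentalRep (Fin N)) β) :=
  integrable_of_continuous (fundamentalLatticeRep N) β
    (Complex.continuous_conj.comp' (continuous_trace_fundamentalRep_wordHolonomy N x w))

/-- `tr hol_x(v) · tr hol_y(w)` is integrable for Wilson's measure. [folklore] -/
theorem integrable_trace_mul_trace [NeZero L] (β : ℝ) (x y : Site d L) (v w : Word d) :
    Integrable (fun U : GaugeConfig d L (Matrix.specialUnitaryGroup (Fin N) ℂ) =>
      (fundamentalRep (Fin N) (wordHolonomy U x v)).trace * (fundamentalRep (Fin N) (wordHolonomy U y w)).trace)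
      (wilsonMeasure (d := d) (L := L) (fundamentalRep (Fin N)) β) :=
  integrable_of_continuous (fundamentalLatticeRep N) β
    ((continuous_trace_fundamentalRep_wordHolonomy N x v).mul (continuous_trace_fundamentalRep_wordHolonomy N y w))

/-- `conj(tr hol_x(v)) · tr hol_y(w)` is integrable for Wilson's measure. [folklore] -/
theorem integrable_conj_trace_mul_trace [NeZero L] (β : ℝ) (x y : Site d L) (v w : Word d) :
    Integrable (fun U : GaugeConfig d L (Matrix.specialUnitaryGroup (Fin N) ℂ) =>
      conj (fundamentalRep (Fin N) (wordHolonomy U x v)).trace * (fundamentalRep (Fin N) (wordHolonomy U y w)).trace)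
      (wilsonMeasure (d := d) (L := L) (fundamentalRep (Fin N)) β) :=
  integrable_of_continuous (fundamentalLatticeRep N) β
    ((Complex.continuous_conj.comp' (continuous_trace_fundamentalRep_wordHolonomy N x v)).mul
      (continuous_trace_fundamentalRep_wordHolonomy N y w))

/-- **`w(C) = (1/N) Re E[tr hol C]`**: the tree's loop variable `⟨wordLoop⟩_β` is the real part of the complex loop
expectation, normalised. [folklore] -/
theorem wilsonExpectation_wordLoop_eq_re_integral [NeZero L] (β : ℝ) (x : Site d L) (w : Word d) :
    wilsonExpectation (d := d) (L := L) (fundamentalRep (Fin N)) β (wordLoop (fundamentalRep (Fin N)) x w) =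
      (N : ℝ)⁻¹ * (∫ U, (fundamentalRep (Fin N) (wordHolonomy U x w)).trace
        ∂(wilsonMeasure (d := d) (L := L) (fundamentalRep (Fin N)) β)).re := by
  have h := integral_re (integrable_trace_wordHolonomy (d := d) (L := L) N β x w)
  simp only [RCLike.re_to_complex] at h
  simp only [wilsonExpectation, wordLoop_apply, integral_const_mul, h]

/-- **Charge conjugation moves the `conj` across a pair**: `E[tr A · conj tr B] = E[conj tr A · tr B]`
(`U ↦ Ū` preserves Wilson's measure and conjugates every trace). [folklore] -/
theorem integral_trace_mul_conj_trace_comm [NeZero L] (β : ℝ) (x y : Site d L) (v w : Word d) :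
    ∫ U, (fundamentalRep (Fin N) (wordHolonomy U x v)).trace * conj (fundamentalRep (Fin N) (wordHolonomy U y w)).trace
        ∂(wilsonMeasure (d := d) (L := L) (fundamentalRep (Fin N)) β) =
      ∫ U, conj (fundamentalRep (Fin N) (wordHolonomy U x v)).trace * (fundamentalRep (Fin N) (wordHolonomy U y w)).trace
        ∂(wilsonMeasure (d := d) (L := L) (fundamentalRep (Fin N)) β) := by
  have h := integral_comp_suConj (d := d) (L := L) N β fun U =>
    conj (fundamentalRep (Fin N) (wordHolonomy U x v)).trace * (fundamentalRep (Fin N) (wordHolonomy U y w)).trace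
  simp only [trace_wordHolonomy_suConj, Complex.conj_conj] at h
  exact h

/-- **The pair dictionary `d⁻(A, B) = d⁺(A, B⁻¹)`** at the level of complex expectations:
`E[tr A · tr B⁻¹] = E[tr A · conj tr B]` (`B` closed at `y`). [folklore] -/
theorem integral_trace_mul_trace_reverse_closed [NeZero L] (β : ℝ) (x y : Site d L) (v w : Word d)
    (hw : Word.endpoint y w = y) :
    ∫ U, (fundamentalRep (Fin N) (wordHolonomy U x v)).trace *
          (fundamentalRep (Fin N) (wordHolonomy U y (Word.reverse w))).trace
        ∂(wilsonMeasure (d := d) (L := L) (fundamentalRep (Fin N)) β) =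
      ∫ U, (fundamentalRep (Fin N) (wordHolonomy U x v)).trace * conj (fundamentalRep (Fin N) (wordHolonomy U y w)).trace
        ∂(wilsonMeasure (d := d) (L := L) (fundamentalRep (Fin N)) β) := by
  simp_rw [trace_wordHolonomy_reverse_closed N _ y w hw]

/-- **Joint reversal is the `C`-image of a pair**: `E[tr A⁻¹ · tr B⁻¹] = conj E[tr A · tr B]` for closed words `A`
at `x` and `B` at `y`. [folklore] -/
theorem integral_trace_reverse_mul_trace_reverse_closed [NeZero L] (β : ℝ) (x y : Site d L) (v w : Word d)
    (hv : Word.endpoint x v = x) (hw : Word.endpoint y w = y) :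
    ∫ U, (fundamentalRep (Fin N) (wordHolonomy U x (Word.reverse v))).trace *
          (fundamentalRep (Fin N) (wordHolonomy U y (Word.reverse w))).trace
        ∂(wilsonMeasure (d := d) (L := L) (fundamentalRep (Fin N)) β) =
      conj (∫ U, (fundamentalRep (Fin N) (wordHolonomy U x v)).trace * (fundamentalRep (Fin N) (wordHolonomy U y w)).trace
        ∂(wilsonMeasure (d := d) (L := L) (fundamentalRep (Fin N)) β)) := by
  rw [← integral_conj]
  simp_rw [map_mul, trace_wordHolonomy_reverse_closed N _ x v hv, trace_wordHolonomy_reverse_closed N _ y w hw]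

/-- **The pair variable is JOINT-reversal invariant**: `Re E[tr A⁻¹ · tr B⁻¹] = Re E[tr A · tr B]` (the `SU(3)` pair
classes of the generators are taken modulo swap × joint reversal; a single reversal is NOT a symmetry for `N ≥ 3`,
see `integral_trace_mul_trace_reverse_closed`). [folklore] -/
theorem re_integral_trace_reverse_mul_trace_reverse_closed [NeZero L] (β : ℝ) (x y : Site d L) (v w : Word d)
    (hv : Word.endpoint x v = x) (hw : Word.endpoint y w = y) :
    (∫ U, (fundamentalRep (Fin N) (wordHolonomy U x (Word.reverse v))).trace *
          (fundamentalRep (Fin N) (wordHolonomy U y (Word.reverse w))).trace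
        ∂(wilsonMeasure (d := d) (L := L) (fundamentalRep (Fin N)) β)).re =
      (∫ U, (fundamentalRep (Fin N) (wordHolonomy U x v)).trace * (fundamentalRep (Fin N) (wordHolonomy U y w)).trace
        ∂(wilsonMeasure (d := d) (L := L) (fundamentalRep (Fin N)) β)).re := by
  rw [integral_trace_reverse_mul_trace_reverse_closed N β x y v w hv hw, Complex.conj_re]

/-- **`d(A, B)` two ways**: `E[Re(tr A · tr B)] = Re E[tr A · tr B]`. [folklore] -/
theorem integral_re_trace_mul_trace [NeZero L] (β : ℝ) (x y : Site d L) (v w : Word d) :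
    ∫ U, ((fundamentalRep (Fin N) (wordHolonomy U x v)).trace * (fundamentalRep (Fin N) (wordHolonomy U y w)).trace).re
        ∂(wilsonMeasure (d := d) (L := L) (fundamentalRep (Fin N)) β) =
      (∫ U, (fundamentalRep (Fin N) (wordHolonomy U x v)).trace * (fundamentalRep (Fin N) (wordHolonomy U y w)).trace
        ∂(wilsonMeasure (d := d) (L := L) (fundamentalRep (Fin N)) β)).re := by
  have h := integral_re (integrable_trace_mul_trace (d := d) (L := L) N β x y v w)
  simpa only [RCLike.re_to_complex] using h

/-- **Pair variables are real**: `Im E[conj tr A · tr B] = 0` (the integrand is charge-conjugation covariant).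
[folklore] -/
theorem im_integral_conj_trace_mul_trace_eq_zero [NeZero L] (β : ℝ) (x y : Site d L) (v w : Word d) :
    (∫ U, conj (fundamentalRep (Fin N) (wordHolonomy U x v)).trace * (fundamentalRep (Fin N) (wordHolonomy U y w)).trace
        ∂(wilsonMeasure (d := d) (L := L) (fundamentalRep (Fin N)) β)).im = 0 :=
  im_integral_eq_zero_of_suConj N β fun U => by
    simp only [trace_wordHolonomy_suConj, map_mul, Complex.conj_conj]

/-- **Pair variables are real**: `Im E[tr A · tr B] = 0`. [folklore] -/
theorem im_integral_trace_mul_trace_eq_zero [NeZero L] (β : ℝ) (x y : Site d L) (v w : Word d) :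
    (∫ U, (fundamentalRep (Fin N) (wordHolonomy U x v)).trace * (fundamentalRep (Fin N) (wordHolonomy U y w)).trace
        ∂(wilsonMeasure (d := d) (L := L) (fundamentalRep (Fin N)) β)).im = 0 :=
  im_integral_eq_zero_of_suConj N β fun U => by
    simp only [trace_wordHolonomy_suConj, map_mul]

/-- `E[conj tr hol C] = E[tr hol C]` (both equal the real number `conj E[tr hol C] = E[tr hol C]`). [folklore] -/
theorem integral_conj_trace_wordHolonomy [NeZero L] (β : ℝ) (x : Site d L) (w : Word d) :
    ∫ U, conj (fundamentalRep (Fin N) (wordHolonomy U x w)).trace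
        ∂(wilsonMeasure (d := d) (L := L) (fundamentalRep (Fin N)) β) =
      ∫ U, (fundamentalRep (Fin N) (wordHolonomy U x w)).trace
        ∂(wilsonMeasure (d := d) (L := L) (fundamentalRep (Fin N)) β) := by
  rw [integral_conj]
  exact conj_integral_eq_of_suConj N β fun U => trace_wordHolonomy_suConj N U x w

end Expectation

/-! ## The `SU(3)` rows among torus expectations -/

section SU3Rows

variable {d L : ℕ}

/-- **T1 among torus expectations (T1-E)**: for lattice `SU(3)` Yang–Mills on `(ℤ/L)^d` (every real `β`, every `d`,
every `L ≥ 1`), a CLOSED word `X` at `x` and any word `Y` from `x`,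
`E[conj(tr hol X) · tr hol Y] = E[tr hol(X⁻¹Y)] + E[tr hol X · tr hol(XY)] − E[tr hol(X²Y)]`. [folklore] -/
theorem su3_integral_pair_identity [NeZero L] (β : ℝ) (x : Site d L) (X Y : Word d)
    (hX : Word.endpoint x X = x) :
    ∫ U, conj (fundamentalRep (Fin 3) (wordHolonomy U x X)).trace * (fundamentalRep (Fin 3) (wordHolonomy U x Y)).trace
        ∂(wilsonMeasure (d := d) (L := L) (fundamentalRep (Fin 3)) β) =
      ∫ U, (fundamentalRep (Fin 3) (wordHolonomy U x (Word.reverse X ++ Y))).trace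
          ∂(wilsonMeasure (d := d) (L := L) (fundamentalRep (Fin 3)) β) +
        ∫ U, (fundamentalRep (Fin 3) (wordHolonomy U x X)).trace *
            (fundamentalRep (Fin 3) (wordHolonomy U x (X ++ Y))).trace
          ∂(wilsonMeasure (d := d) (L := L) (fundamentalRep (Fin 3)) β) -
        ∫ U, (fundamentalRep (Fin 3) (wordHolonomy U x (X ++ (X ++ Y)))).trace
          ∂(wilsonMeasure (d := d) (L := L) (fundamentalRep (Fin 3)) β) := by
  simp_rw [su3_pair_identity_wordHolonomy _ x X Y hX]
  rw [integral_sub ((integrable_trace_wordHolonomy 3 β x _).fun_add (integrable_trace_mul_trace 3 β x x X _))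
      (integrable_trace_wordHolonomy 3 β x _),
    integral_add (integrable_trace_wordHolonomy 3 β x _) (integrable_trace_mul_trace 3 β x x X _)]

/-- **The T1 row in the generators' real normal form** (KIN-CENSUS-G1 §H; G1 `kin_su3audit_g1 --t1-out`, G2
`t1_tier_g2`): with `w(C) = ⟨wordLoop⟩_β = E[(1/3) Re tr hol C]` and `d(A, B) = Re E[tr hol A · tr hol B] / 9`,
for a closed word `X` at `x` and any word `Y` from `x`,
`d(X⁻¹, Y) − d(X, XY) − w(X⁻¹Y)/3 + w(X²Y)/3 = 0` (the generators' "CH family"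
`(1/3) w(AAB) − Re⟨W_A W_AB⟩ + Re⟨W_A* W_B⟩ − (1/3) w(A⁻¹B) = 0`, `W = (1/3) tr`, is the same row reordered). [folklore] -/
theorem su3_t1_row [NeZero L] (β : ℝ) (x : Site d L) (X Y : Word d) (hX : Word.endpoint x X = x) :
    (∫ U, (fundamentalRep (Fin 3) (wordHolonomy U x (Word.reverse X))).trace *
          (fundamentalRep (Fin 3) (wordHolonomy U x Y)).trace
        ∂(wilsonMeasure (d := d) (L := L) (fundamentalRep (Fin 3)) β)).re / 9 -
      (∫ U, (fundamentalRep (Fin 3) (wordHolonomy U x X)).trace *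
          (fundamentalRep (Fin 3) (wordHolonomy U x (X ++ Y))).trace
        ∂(wilsonMeasure (d := d) (L := L) (fundamentalRep (Fin 3)) β)).re / 9 -
      wilsonExpectation (d := d) (L := L) (fundamentalRep (Fin 3)) β
          (wordLoop (fundamentalRep (Fin 3)) x (Word.reverse X ++ Y)) / 3 +
      wilsonExpectation (d := d) (L := L) (fundamentalRep (Fin 3)) β
          (wordLoop (fundamentalRep (Fin 3)) x (X ++ (X ++ Y))) / 3 = 0 := by
  simp_rw [trace_wordHolonomy_reverse_closed 3 _ x X hX]
  rw [wilsonExpectation_wordLoop_eq_re_integral, wilsonExpectation_wordLoop_eq_re_integral,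
    su3_integral_pair_identity β x X Y hX]
  simp only [Complex.add_re, Complex.sub_re]
  push_cast
  ring

/-- **The NEWTON row** (the `SU(3)` equality row of every rung; rung 0: `d(P, P) = w(P²)/3 + 2 w(P)/3` for the
plaquette, KIN-CENSUS-G1 §I (i)): for a closed word `X` at `x`, `Re E[(tr hol X)²]/9 = w(X²)/3 + 2 w(X)/3`. [folklore] -/
theorem su3_newton_row [NeZero L] (β : ℝ) (x : Site d L) (X : Word d) (hX : Word.endpoint x X = x) :
    (∫ U, (fundamentalRep (Fin 3) (wordHolonomy U x X)).trace * (fundamentalRep (Fin 3) (wordHolonomy U x X)).trace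
        ∂(wilsonMeasure (d := d) (L := L) (fundamentalRep (Fin 3)) β)).re / 9 =
      wilsonExpectation (d := d) (L := L) (fundamentalRep (Fin 3)) β (wordLoop (fundamentalRep (Fin 3)) x (X ++ X)) / 3 +
        2 * wilsonExpectation (d := d) (L := L) (fundamentalRep (Fin 3)) β (wordLoop (fundamentalRep (Fin 3)) x X) / 3 := by
  simp_rw [su3_newton_wordHolonomy _ x X hX]
  rw [integral_add (integrable_trace_wordHolonomy 3 β x _) ((integrable_conj_trace_wordHolonomy 3 β x X).const_mul 2),
    integral_const_mul, integral_conj_trace_wordHolonomy, wilsonExpectation_wordLoop_eq_re_integral,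
    wilsonExpectation_wordLoop_eq_re_integral]
  simp only [Complex.add_re, Complex.mul_re, Complex.re_ofNat, Complex.im_ofNat]
  push_cast
  ring

/-- **The MODULUS row** (`T1` with `Y = X`): for a closed word `X` at `x`,
`d(X⁻¹, X) = d(X, X²) − w(X³)/3 + 1/3` (the audit's `d(A, A⁻¹) = d(A², A) − w(A³)/3 + 1/3`; `d` is symmetric under
swap), i.e. `Re E[tr hol X⁻¹ · tr hol X]/9 = Re E[tr hol X · tr hol(X²)]/9 − w(X³)/3 + 1/3`. [folklore] -/
theorem su3_modulus_row [NeZero L] (β : ℝ) (x : Site d L) (X : Word d) (hX : Word.endpoint x X = x) :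
    (∫ U, (fundamentalRep (Fin 3) (wordHolonomy U x (Word.reverse X))).trace *
          (fundamentalRep (Fin 3) (wordHolonomy U x X)).trace
        ∂(wilsonMeasure (d := d) (L := L) (fundamentalRep (Fin 3)) β)).re / 9 =
      (∫ U, (fundamentalRep (Fin 3) (wordHolonomy U x X)).trace *
            (fundamentalRep (Fin 3) (wordHolonomy U x (X ++ X))).trace
          ∂(wilsonMeasure (d := d) (L := L) (fundamentalRep (Fin 3)) β)).re / 9 -
        wilsonExpectation (d := d) (L := L) (fundamentalRep (Fin 3)) β
            (wordLoop (fundamentalRep (Fin 3)) x (X ++ (X ++ X))) / 3 + 1 / 3 := by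
  haveI := isProbabilityMeasure_wilsonMeasure (d := d) (L := L) (fundamentalRep (Fin 3))
    (continuous_fundamentalRep (Fin 3)) β
  -- `hol_x(X⁻¹ X) = 1`, so its trace is `3` and its expectation is `3`
  have h1 : ∀ U : GaugeConfig d L (Matrix.specialUnitaryGroup (Fin 3) ℂ),
      (fundamentalRep (Fin 3) (wordHolonomy U x (Word.reverse X ++ X))).trace = 3 := fun U => by
    rw [wordHolonomy_reverse_append_closed U x X X hX, inv_mul_cancel, map_one, Matrix.trace_one,
      Fintype.card_fin]
    norm_num
  have hT := su3_integral_pair_identity (d := d) (L := L) β x X X hX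
  simp only [h1, integral_const, probReal_univ, one_smul] at hT
  simp_rw [trace_wordHolonomy_reverse_closed 3 _ x X hX]
  rw [hT, wilsonExpectation_wordLoop_eq_re_integral]
  simp only [Complex.add_re, Complex.sub_re, Complex.re_ofNat]
  push_cast
  ring

/-- **The rung-0 `SU(3)` equality row of record**: for the plaquette `P = +eᵢ +eⱼ −eᵢ −eⱼ` at `x` (tree
`Word.plaquette`, holonomy = the tree's `plaquetteHolonomy` by `wordHolonomy_plaquette`),
`d(P, P) = w(P²)/3 + 2 w(P)/3` — the one kinematical row of the rung-0 problems `certs/SU3-D*/rung0` (KIN-CENSUS-G1 §I (i)),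
every real `β`, every `d`, every `L ≥ 1`. [folklore] -/
theorem su3_newton_row_plaquette [NeZero L] (β : ℝ) (x : Site d L) (i j : Fin d) :
    (∫ U, (fundamentalRep (Fin 3) (wordHolonomy U x (Word.plaquette i j))).trace *
          (fundamentalRep (Fin 3) (wordHolonomy U x (Word.plaquette i j))).trace
        ∂(wilsonMeasure (d := d) (L := L) (fundamentalRep (Fin 3)) β)).re / 9 =
      wilsonExpectation (d := d) (L := L) (fundamentalRep (Fin 3)) β
          (wordLoop (fundamentalRep (Fin 3)) x (Word.plaquette i j ++ Word.plaquette i j)) / 3 +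
        2 * wilsonExpectation (d := d) (L := L) (fundamentalRep (Fin 3)) β
          (wordLoop (fundamentalRep (Fin 3)) x (Word.plaquette i j)) / 3 :=
  su3_newton_row β x (Word.plaquette i j) (endpoint_plaquette x i j)

end SU3Rows

end Summit.QuantumFields.GaugeBoot

end
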